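import Summits.CriticalPhenomena.PercolationContinuityZ3.Theorems.Transplant.PlanarCells2SepS
import Summits.CriticalPhenomena.PercolationContinuityZ3.Theorems.Transplant.PlanarCells2SepInf
import HarnessLib

/-!
# STAGGERED two-unit planar cells `PCells2S`: ℓ^∞-GAP SEPARATIONS — the `PCells2S` twin of `PlanarCells2SepInf` over the staggered centres,
# the arms of record `BtwNS` ((R-29)/J7) and the far regions of record `FarNS = BtwNS ∪ QNS v δ 1` ((R-27))

WAVE-1 Geom re-base (typer p3-g15; sieve p5-g15).  Same engine as PlanarCells2SepS (`sep_small_or_far` / `small_cases`, J6): in the small case every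
leaf exhibits a coordinate with a gap `≥ 2` (`gap2`, the disjunction closed by `omega`), in the far case the `38 r` gap does.  The sibling pair that is
tight in the one-unit world (`BtwN v δ′` against `E^far_{v,δ}`, gap exactly `2`) has gap `2 + c` here.  Then the narrow probe world of record
`probeWorldNS v δ du = BtwNS v δ ∪ Q x ∪ Hfull x du ⊆ FarNS v δ ∪ Q x ∪ FarNS x du` and the scheme's `hSQ / hSB / hSS` in gap-2 and `ℤ²` form, with
hp-8 g27's lineage hypotheses verbatim.  Statements in explicit-application form `PCells2S.X P …`.
builds on p205010 (kernel theorem, internal audit signed; external expert review pending) — nothing here uses p205010 or claims anything about the open node.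
Lane `prim-bschramm`, seat `prim-bschramm-p3` (gen 15; N2 design owner); helper file (`--supports stmt-CriticalPhenomena-4575 --as helper`).
[cite: KozmaNitzan2024, §4 p. 26 ((29)), p. 31 ((31))]
-/

noncomputable section

namespace Summit.CriticalPhenomena.PercolationContinuityZ3.Theorems

namespace Transplant
open Literature.Probability.Percolation Literature.Probability.LatticeModels SimpleGraph GadgetSystem Contour
open Literature.Probability.Percolation.KozmaNitzan
open Literature.Probability.Percolation.KozmaNitzan.Cells (oth oth_ne sgOf sgOf_sign stepVec_apply_fst stepVec_apply_oth eq_oth_of_ne oth_oth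
  eq_of_coords)
open PlanarSkeleton (SepInf)
open PCells (mem_psBox_iff sepInf_of_gap sepZ2_of_sepInf sepInf_union_left sepInf_union_right)

namespace PCells2S

variable (P : PCells2S)

/-- A gap of `2` along `a` or across `a`, as a disjunction `omega` can close. [folklore] -/
theorem gap2 {y z : Site 2} (a : Fin 2)
    (h : y a + 2 ≤ z a ∨ z a + 2 ≤ y a ∨ y (oth a) + 2 ≤ z (oth a) ∨ z (oth a) + 2 ≤ y (oth a)) : ∃ j : Fin 2, (2 : ℤ) ≤ |y j - z j| := by
  rcases h with h | h | h | h
  · exact sepInf_of_gap a (Or.inl h)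
  · exact sepInf_of_gap a (Or.inr h)
  · exact sepInf_of_gap (oth a) (Or.inl h)
  · exact sepInf_of_gap (oth a) (Or.inr h)

/-! ## §1 Cells and zones against cubes -/

/-- **Cells of other macro-vertices are ℓ^∞-gap separated from the cube `Q_v`.** [cite: KozmaNitzan2024, §4 p. 26] -/
theorem Cell_sepInf_Q {u v : Site 2} (huv : u ≠ v) : SepInf (↑(PCells2S.Cell P u) : Set (Site 2)) ↑(PCells2S.Q P v) := by
  intro y hy z hz
  rw [Finset.mem_coe, Cell, mem_aboxS_iff] at hy
  rw [Finset.mem_coe, Q, mem_aboxS_iff] at hz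
  have hya := hy 0; have hyo := hy (oth 0); have hza := hz 0; have hzo := hz (oth 0)
  push_cast at hya hyo hza hzo
  have hsz := P.size_facts 0
  rcases P.sep_small_or_far 0 u v with ⟨hm, hk⟩ | hfar | hfar
  · obtain ⟨m, k, hm3, hk3, hxu, hxu', ea, eo⟩ := P.small_cases 0 u v hm hk
    have hne : ¬(m = 0 ∧ k = 0) := by
      rintro ⟨rfl, rfl⟩; exact huv (eq_of_coords 0 (by omega) (by omega))
    rcases hm3 with rfl | rfl | rfl <;> rcases hk3 with rfl | rfl | rfl <;> exact gap2 0 (by omega)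
  · exact gap2 0 (by rcases le_abs.1 hfar with hh | hh <;> omega)
  · exact gap2 0 (by rcases le_abs.1 hfar with hh | hh <;> omega)

/-- **Stub zones are ℓ^∞-gap separated from every cube** (the row-neighbour's cube: gap `10 s ≥ 2`). [cite: KozmaNitzan2024, §4 p. 26] -/
theorem Zone_sepInf_Q (u : Site 2) (δ : MDir) (v : Site 2) : SepInf (↑(PCells2S.Zone P u δ) : Set (Site 2)) ↑(PCells2S.Q P v) := by
  intro y hy z hz
  rw [Finset.mem_coe, Zone, mem_psBox_iff] at hy
  rw [Finset.mem_coe, Q, mem_aboxS_iff] at hz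
  obtain ⟨⟨h1, h2⟩, h3, h4⟩ := hy
  have hza := hz δ.1; have hzo := hz (oth δ.1)
  push_cast at hza hzo h1 h2 h3 h4
  have hsz := P.size_facts δ.1
  rcases P.sep_small_or_far δ.1 u v with ⟨hm, hk⟩ | hfar | hfar
  · obtain ⟨m, k, hm3, hk3, hxu, hxu', ea, eo⟩ := P.small_cases δ.1 u v hm hk
    rcases hm3 with rfl | rfl | rfl <;> rcases hk3 with rfl | rfl | rfl <;> rcases sgOf_sign δ with hs | hs <;> rw [hs] at h1 h2 <;>
      exact gap2 δ.1 (by omega)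
  · exact gap2 δ.1 (by rcases le_abs.1 hfar with hh | hh <;> omega)
  · exact gap2 δ.1 (by rcases sgOf_sign δ with hs | hs <;> rw [hs] at h1 h2 <;> rcases le_abs.1 hfar with hh | hh <;> omega)

/-! ## §2 Cells and zones against the arms of record -/

/-- **Cells off the edge are ℓ^∞-gap separated from the between-box of record `BtwNS v δ`** (`u ≠ v`, `u ≠ v + δ`). [cite: KozmaNitzan2024, §4 p. 31] -/
theorem Cell_sepInf_BtwNS {u v : Site 2} {δ : MDir} (huv : u ≠ v) (hux : u ≠ v + stepVec δ) :
    SepInf (↑(PCells2S.Cell P u) : Set (Site 2)) ↑(PCells2S.BtwNS P v δ) := by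
  intro y hy z hz
  rw [Finset.mem_coe, Cell, mem_aboxS_iff] at hy
  rw [Finset.mem_coe, mem_BtwNS_iff] at hz
  obtain ⟨⟨h1, h2⟩, h3, h4⟩ := hz
  have hya := hy δ.1; have hyo := hy (oth δ.1)
  push_cast at hya hyo
  have hsz := P.size_facts δ.1
  rcases P.sep_small_or_far δ.1 v u with ⟨hm, hk⟩ | hfar | hfar
  · obtain ⟨m, k, hm3, hk3, hxu, hxu', ea, eo⟩ := P.small_cases δ.1 v u hm hk
    have hne : ¬(m = 0 ∧ k = 0) := by
      rintro ⟨rfl, rfl⟩; exact huv (eq_of_coords δ.1 (by omega) (by omega))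
    have hne' : ¬(m = sgOf δ ∧ k = 0) := by
      rintro ⟨hm0, rfl⟩
      refine hux (eq_of_coords δ.1 ?_ ?_)
      · rw [Pi.add_apply, stepVec_apply_fst]; omega
      · rw [Pi.add_apply, stepVec_apply_oth, add_zero]; omega
    rcases hm3 with rfl | rfl | rfl <;> rcases hk3 with rfl | rfl | rfl <;> rcases sgOf_sign δ with hs | hs <;> rw [hs] at h1 h2 hne' <;>
      exact gap2 δ.1 (by omega)
  · exact gap2 δ.1 (by rcases le_abs.1 hfar with hh | hh <;> omega)
  · exact gap2 δ.1 (by rcases sgOf_sign δ with hs | hs <;> rw [hs] at h1 h2 <;> rcases le_abs.1 hfar with hh | hh <;> omega)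

/-- **Stub zones off the edge are ℓ^∞-gap separated from `BtwNS v δ`** (`u ≠ v`, `u ≠ v + δ`; tightest gap `10 s + 1 + c ≥ 2`).
[cite: KozmaNitzan2024, §4 p. 31] -/
theorem Zone_sepInf_BtwNS {u v : Site 2} {δ : MDir} (huv : u ≠ v) (hux : u ≠ v + stepVec δ) (δ' : MDir) :
    SepInf (↑(PCells2S.Zone P u δ') : Set (Site 2)) ↑(PCells2S.BtwNS P v δ) := by
  intro y hy z hz
  rw [Finset.mem_coe, Zone, mem_psBox_iff] at hy
  rw [Finset.mem_coe, mem_BtwNS_iff] at hz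
  obtain ⟨⟨hy1, hy2⟩, hy3, hy4⟩ := hy
  obtain ⟨⟨h1, h2⟩, h3, h4⟩ := hz
  have hsz := P.size_facts δ.1
  have hsz' := P.size_facts (oth δ.1)
  rw [oth_oth] at hsz'
  have key : ∀ (a : Fin 2), a = δ'.1 → (a = δ.1 ∨ a = oth δ.1) → ∃ j : Fin 2, (2 : ℤ) ≤ |y j - z j| := by
    rintro a rfl hax
    rcases P.sep_small_or_far δ.1 v u with ⟨hm, hk⟩ | hfar | hfar
    · obtain ⟨m, k, hm3, hk3, hxu, hxu', ea, eo⟩ := P.small_cases δ.1 v u hm hk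
      have hne : ¬(m = 0 ∧ k = 0) := by
        rintro ⟨rfl, rfl⟩; exact huv (eq_of_coords δ.1 (by omega) (by omega))
      have hne' : ¬(m = sgOf δ ∧ k = 0) := by
        rintro ⟨hm0, rfl⟩
        refine hux (eq_of_coords δ.1 ?_ ?_)
        · rw [Pi.add_apply, stepVec_apply_fst]; omega
        · rw [Pi.add_apply, stepVec_apply_oth, add_zero]; omega
      rcases hax with hax | hax <;> rw [hax] at hy1 hy2 hy3 hy4 <;> (try rw [oth_oth] at hy3 hy4) <;>
        rcases hm3 with rfl | rfl | rfl <;> rcases hk3 with rfl | rfl | rfl <;> rcases sgOf_sign δ with hs | hs <;>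
          rcases sgOf_sign δ' with hs' | hs' <;> rw [hs] at h1 h2 hne' <;> rw [hs'] at hy1 hy2 <;> exact gap2 δ.1 (by omega)
    · rcases hax with hax | hax <;> rw [hax] at hy1 hy2 hy3 hy4 <;> (try rw [oth_oth] at hy3 hy4) <;>
        rcases sgOf_sign δ' with hs' | hs' <;> rw [hs'] at hy1 hy2 <;> exact gap2 δ.1 (by rcases le_abs.1 hfar with hh | hh <;> omega)
    · rcases hax with hax | hax <;> rw [hax] at hy1 hy2 hy3 hy4 <;> (try rw [oth_oth] at hy3 hy4) <;>
        rcases sgOf_sign δ with hs | hs <;> rcases sgOf_sign δ' with hs' | hs' <;> rw [hs] at h1 h2 <;> rw [hs'] at hy1 hy2 <;>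
          exact gap2 δ.1 (by rcases le_abs.1 hfar with hh | hh <;> omega)
  by_cases hax : δ'.1 = δ.1
  · exact key δ'.1 rfl (Or.inl hax)
  · exact key δ'.1 rfl (Or.inr (eq_oth_of_ne hax))

/-- **Cells off the edge are ℓ^∞-gap separated from the far region of record `FarNS v δ`.** [cite: KozmaNitzan2024, §4 p. 31] -/
theorem Cell_sepInf_FarNS {u v : Site 2} {δ : MDir} (huv : u ≠ v) (hux : u ≠ v + stepVec δ) :
    SepInf (↑(PCells2S.Cell P u) : Set (Site 2)) ↑(PCells2S.FarNS P v δ) := by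
  rw [FarNS, Finset.coe_union]
  exact sepInf_union_right (P.Cell_sepInf_BtwNS huv hux)
    ((P.Cell_sepInf_Q hux).mono le_rfl (Finset.coe_subset.2 (QNS_subset_Q v δ 1)))

/-- **Stub zones off the edge are ℓ^∞-gap separated from `FarNS v δ`.** [cite: KozmaNitzan2024, §4 p. 31] -/
theorem Zone_sepInf_FarNS {u v : Site 2} {δ : MDir} (huv : u ≠ v) (hux : u ≠ v + stepVec δ) (δ' : MDir) :
    SepInf (↑(PCells2S.Zone P u δ') : Set (Site 2)) ↑(PCells2S.FarNS P v δ) := by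
  rw [FarNS, Finset.coe_union]
  exact sepInf_union_right (P.Zone_sepInf_BtwNS huv hux δ')
    ((P.Zone_sepInf_Q u δ' _).mono le_rfl (Finset.coe_subset.2 (QNS_subset_Q v δ 1)))

/-! ## §3 Sibling arms of one macro-vertex -/

/-- **Sibling between-boxes of record are ℓ^∞-gap separated** (`δ' ≠ δ`; opposite: gap `10r + 2`; perpendicular: gap `2 + c`). [cite: KozmaNitzan2024, §4 p. 31 ((31))] -/
theorem BtwNS_sepInf_BtwNS_self (v : Site 2) {δ δ' : MDir} (h : δ' ≠ δ) :
    SepInf (↑(PCells2S.BtwNS P v δ') : Set (Site 2)) ↑(PCells2S.BtwNS P v δ) := by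
  intro y hy z hz
  rw [Finset.mem_coe, mem_BtwNS_iff] at hy hz
  obtain ⟨⟨hy1, hy2⟩, hy3, hy4⟩ := hy
  obtain ⟨⟨hz1, hz2⟩, hz3, hz4⟩ := hz
  have hsz := P.size_facts δ.1
  have hc1 := P.c_nonneg δ'.1
  by_cases hax : δ'.1 = δ.1
  · rcases dir_eq_or_rev hax with ⟨-, hδ⟩ | ⟨hsg, -⟩
    · exact absurd hδ h
    · rw [hax, hsg] at hy1 hy2
      exact gap2 δ.1 (by rcases sgOf_sign δ with hs | hs <;> rw [hs] at hy1 hy2 hz1 hz2 <;> omega)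
  · have hoth : δ.1 = oth δ'.1 := eq_oth_of_ne (Ne.symm hax)
    rw [← hoth] at hy3 hy4
    exact gap2 δ.1 (by rcases sgOf_sign δ with hs | hs <;> rw [hs] at hz1 <;> omega)

/-- **A sibling between-box of record is ℓ^∞-gap separated from the target cube `Q (v+δ)`** (`δ' ≠ δ`). [cite: KozmaNitzan2024, §4 p. 26 ((29))] -/
theorem BtwNS_sepInf_Q_add (v : Site 2) {δ δ' : MDir} (h : δ' ≠ δ) :
    SepInf (↑(PCells2S.BtwNS P v δ') : Set (Site 2)) ↑(PCells2S.Q P (v + stepVec δ)) := by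
  intro y hy z hz
  rw [Finset.mem_coe, mem_BtwNS_iff] at hy
  rw [Finset.mem_coe, Q, mem_aboxS_iff] at hz
  obtain ⟨⟨hy1, hy2⟩, hy3, hy4⟩ := hy
  have hza := hz δ.1
  rw [P.cenS_add_stepVec_fst] at hza
  push_cast at hza
  have hsz := P.size_facts δ.1
  have hc1 := P.c_nonneg δ'.1
  by_cases hax : δ'.1 = δ.1
  · rcases dir_eq_or_rev hax with ⟨-, hδ⟩ | ⟨hsg, -⟩
    · exact absurd hδ h
    · rw [hax, hsg] at hy1 hy2
      exact gap2 δ.1 (by rcases sgOf_sign δ with hs | hs <;> rw [hs] at hy1 hy2 hza <;> omega)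
  · have hoth : δ.1 = oth δ'.1 := eq_oth_of_ne (Ne.symm hax)
    rw [← hoth] at hy3 hy4
    exact gap2 δ.1 (by rcases sgOf_sign δ with hs | hs <;> rw [hs] at hza <;> omega)

/-- **A sibling between-box of record is ℓ^∞-gap separated from the far region of record `FarNS v δ`.** [cite: KozmaNitzan2024, §4 p. 31 ((31))] -/
theorem BtwNS_sepInf_FarNS (v : Site 2) {δ δ' : MDir} (h : δ' ≠ δ) :
    SepInf (↑(PCells2S.BtwNS P v δ') : Set (Site 2)) ↑(PCells2S.FarNS P v δ) := by
  rw [FarNS, Finset.coe_union]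
  exact sepInf_union_right (P.BtwNS_sepInf_BtwNS_self v h)
    ((P.BtwNS_sepInf_Q_add v h).mono le_rfl (Finset.coe_subset.2 (QNS_subset_Q v δ 1)))

/-- **The between-box of record of `w → x := w + δw` is ℓ^∞-gap separated from every between-box of record of `x` except the one pointing back**
(straight on: gap `10r + 2` along; perpendicular: the arm of `x` keeps its across-coordinate within `5r − 1 − c` of `cenS x_a = cenS w_a ± 20r`, gap
`2 + c` beyond the level `15r − 1` of the arm of `w`) — J5's replacement for the false `BtwN_rev'` rewrite. [cite: KozmaNitzan2024, §4 p. 31 ((31))] -/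
theorem BtwNS_sepInf_BtwNS_add (w : Site 2) {δw du : MDir} (h : du ≠ rev δw) :
    SepInf (↑(PCells2S.BtwNS P w δw) : Set (Site 2)) ↑(PCells2S.BtwNS P (w + stepVec δw) du) := by
  intro y hy z hz
  rw [Finset.mem_coe, mem_BtwNS_iff] at hy hz
  obtain ⟨⟨hy1, hy2⟩, hy3, hy4⟩ := hy
  obtain ⟨⟨hz1, hz2⟩, hz3, hz4⟩ := hz
  have hf := P.cenS_add_stepVec_fst w δw
  have hsz := P.size_facts δw.1
  have hc1 := P.c_nonneg du.1
  by_cases hax : du.1 = δw.1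
  · rcases dir_eq_or_rev hax with ⟨hsg, -⟩ | ⟨-, hδ⟩
    · rw [hax, hsg, hf] at hz1 hz2
      exact gap2 δw.1 (by rcases sgOf_sign δw with hs | hs <;> rw [hs] at hy1 hy2 hz1 hz2 <;> omega)
    · exact absurd hδ h
  · have hoth : du.1 = oth δw.1 := eq_oth_of_ne hax
    rw [hoth, oth_oth, hf] at hz3 hz4
    exact gap2 δw.1 (by rcases sgOf_sign δw with hs | hs <;> rw [hs] at hy1 hy2 hz3 hz4 <;> omega)

/-- **The between-box of record of `w → x` is ℓ^∞-gap separated from the far regions of record `FarNS x du` of `x` in every direction except back**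
(hp-8's `Btw_sep_Efar` slot of `cellGeomSG₂`, without the `rev` rewrite). [cite: KozmaNitzan2024, §4 p. 31 ((31))] -/
theorem BtwNS_sepInf_FarNS_add (w : Site 2) {δw du : MDir} (h : du ≠ rev δw) :
    SepInf (↑(PCells2S.BtwNS P w δw) : Set (Site 2)) ↑(PCells2S.FarNS P (w + stepVec δw) du) := by
  rw [FarNS, Finset.coe_union]
  refine sepInf_union_right (P.BtwNS_sepInf_BtwNS_add w h) ?_
  -- the neighbour-of-the-neighbour's cube: `Q (x + du) ⊆ Cell (x + du)`, a cell off the edge `(w, δw)`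
  have hne1 : w + stepVec δw + stepVec du ≠ w := by
    intro hh
    apply h
    have h1 : stepVec du = -stepVec δw := by
      have := congrArg (fun z : Site 2 => z - w - stepVec δw) hh; simp at this
      linear_combination this
    by_cases hax : du.1 = δw.1
    · rcases dir_eq_or_rev hax with ⟨hsg, -⟩ | ⟨-, hδ⟩
      · have h2 := congrArg (fun z : Site 2 => z du.1) h1
        simp only [stepVec_apply_fst, Pi.neg_apply] at h2
        rw [hax, stepVec_apply_fst, hsg] at h2
        rcases sgOf_sign δw with hs | hs <;> rw [hs] at h2 <;> norm_num at h2
      · exact hδ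
    · have h2 := congrArg (fun z : Site 2 => z du.1) h1
      simp only [stepVec_apply_fst, Pi.neg_apply] at h2
      rw [show du.1 = oth δw.1 from eq_oth_of_ne hax, stepVec_apply_oth] at h2
      rcases sgOf_sign du with hs | hs <;> rw [hs] at h2 <;> norm_num at h2
  have hne2 : w + stepVec δw + stepVec du ≠ w + stepVec δw := by
    intro hh
    have h2 := congrArg (fun z : Site 2 => (z - (w + stepVec δw)) du.1) hh
    simp only [add_sub_cancel_left, sub_self, stepVec_apply_fst, Pi.zero_apply] at h2
    rcases sgOf_sign du with hs | hs <;> rw [hs] at h2 <;> norm_num at h2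
  have hC := P.Cell_sepInf_BtwNS (u := w + stepVec δw + stepVec du) (v := w) (δ := δw) hne1 hne2
  intro y hy z hz
  obtain ⟨j, hj⟩ := hC z (Finset.mem_coe.2 (P.Q_subset_Cell _ (QNS_subset_Q _ du 1 (Finset.mem_coe.1 hz)))) y hy
  exact ⟨j, by rwa [abs_sub_comm] at hj⟩

/-- Self-adjacency of the neighbour's narrowed box `QNS v δ m` (along side `10 r∥ ≥ 2`). [folklore] -/
theorem exists_adj_of_mem_QNS (v : Site 2) (δ : MDir) (m : ℕ) {t : Site 2} (ht : t ∈ PCells2S.QNS P v δ m) :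
    ∃ t' ∈ PCells2S.QNS P v δ m, (zdGraph 2).Adj t t' := by
  unfold QNS sBox at ht ⊢
  refine PCells.exists_adj_of_mem_Icc δ.1 ?_ ht
  simp only [sLo, sHi]
  have := P.one_le_r δ.1
  rcases sgOf_sign δ with hs | hs <;> simp only [hs] <;> norm_num <;> omega

/-- Self-adjacency of the far region of record `FarNS` (each block is self-adjacent). [folklore] -/
theorem exists_adj_of_mem_FarNS (v : Site 2) (δ : MDir) {t : Site 2} (ht : t ∈ PCells2S.FarNS P v δ) :
    ∃ t' ∈ PCells2S.FarNS P v δ, (zdGraph 2).Adj t t' := by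
  rw [FarNS, Finset.mem_union] at ht
  rcases ht with ht | ht
  · obtain ⟨t', ht', h⟩ := P.exists_adj_of_mem_BtwNS v δ ht
    exact ⟨t', Finset.mem_union_left _ ht', h⟩
  · obtain ⟨t', ht', h⟩ := P.exists_adj_of_mem_QNS v δ 1 ht
    exact ⟨t', Finset.mem_union_right _ ht', h⟩

/-! ## §4 `ℤ²` forms -/

/-- `ℤ²` form of `Cell_sepInf_Q`. [cite: KozmaNitzan2024, §4 p. 26] -/
theorem Cell_sep_Q {u v : Site 2} (huv : u ≠ v) : KozmaNitzan.Sep (↑(PCells2S.Cell P u) : Set (Site 2)) ↑(PCells2S.Q P v) :=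
  sepZ2_of_sepInf (P.Cell_sepInf_Q huv)

/-- `ℤ²` form of `Zone_sepInf_Q`. [cite: KozmaNitzan2024, §4 p. 26] -/
theorem Zone_sep_Q (u : Site 2) (δ : MDir) (v : Site 2) : KozmaNitzan.Sep (↑(PCells2S.Zone P u δ) : Set (Site 2)) ↑(PCells2S.Q P v) :=
  sepZ2_of_sepInf (P.Zone_sepInf_Q u δ v)

/-- `ℤ²` form of `Cell_sepInf_FarNS`. [cite: KozmaNitzan2024, §4 p. 31] -/
theorem Cell_sep_FarNS {u v : Site 2} {δ : MDir} (huv : u ≠ v) (hux : u ≠ v + stepVec δ) :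
    KozmaNitzan.Sep (↑(PCells2S.Cell P u) : Set (Site 2)) ↑(PCells2S.FarNS P v δ) :=
  sepZ2_of_sepInf (P.Cell_sepInf_FarNS huv hux)

/-- `ℤ²` form of `Zone_sepInf_FarNS`. [cite: KozmaNitzan2024, §4 p. 31] -/
theorem Zone_sep_FarNS {u v : Site 2} {δ : MDir} (huv : u ≠ v) (hux : u ≠ v + stepVec δ) (δ' : MDir) :
    KozmaNitzan.Sep (↑(PCells2S.Zone P u δ') : Set (Site 2)) ↑(PCells2S.FarNS P v δ) :=
  sepZ2_of_sepInf (P.Zone_sepInf_FarNS huv hux δ')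

/-- `ℤ²` form of `BtwNS_sepInf_FarNS` (hp-8's `Btw_sep_Efar` slot of `cellGeomSG₂`). [cite: KozmaNitzan2024, §4 p. 31 ((31))] -/
theorem BtwNS_sep_FarNS (v : Site 2) {δ δ' : MDir} (h : δ' ≠ δ) :
    KozmaNitzan.Sep (↑(PCells2S.BtwNS P v δ') : Set (Site 2)) ↑(PCells2S.FarNS P v δ) :=
  sepZ2_of_sepInf (P.BtwNS_sepInf_FarNS v h)

/-! ## §5 The narrow probe world of record and `hSQ / hSB / hSS` -/

/-- The probe world of record lies in `FarNS v δ ∪ Q x ∪ FarNS x du` (`x = v + δ`). [folklore] -/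
theorem probeWorldNS_subset (v : Site 2) (δ du : MDir) :
    (↑(PCells2S.probeWorldNS P v δ du) : Set (Site 2)) ⊆
      ↑(PCells2S.FarNS P v δ) ∪ (↑(PCells2S.Q P (v + stepVec δ)) ∪ ↑(PCells2S.FarNS P (v + stepVec δ) du)) := by
  intro t ht
  rw [Finset.mem_coe, probeWorldNS] at ht
  rcases Finset.mem_union.1 ht with ht | ht
  · rcases Finset.mem_union.1 ht with ht | ht
    · exact Or.inl (Finset.mem_coe.2 (P.BtwNS_subset_FarNS v δ ht))
    · exact Or.inr (Or.inl (Finset.mem_coe.2 ht))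
  · rcases Finset.mem_union.1 (P.Hfull_subset_Q_union_FarNS _ du ht) with h' | h'
    · exact Or.inr (Or.inl (Finset.mem_coe.2 h'))
    · exact Or.inr (Or.inr (Finset.mem_coe.2 h'))

/-- **A cell off the lineage is ℓ^∞-gap separated from the probe world of record** (`u ∉ {v, x, y}`). [cite: KozmaNitzan2024, §4 p. 31] -/
theorem Cell_sepInf_probeWorldNS {v u : Site 2} {δ du : MDir} (huv : u ≠ v) (hux : u ≠ v + stepVec δ)
    (huy : u ≠ v + stepVec δ + stepVec du) : SepInf (↑(PCells2S.Cell P u) : Set (Site 2)) ↑(PCells2S.probeWorldNS P v δ du) :=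
  (sepInf_union_right (P.Cell_sepInf_FarNS huv hux)
    (sepInf_union_right (P.Cell_sepInf_Q hux) (P.Cell_sepInf_FarNS hux huy))).mono le_rfl (P.probeWorldNS_subset v δ du)

/-- **A stub zone off the lineage is ℓ^∞-gap separated from the probe world of record** (`u ∉ {v, x, y}`). [cite: KozmaNitzan2024, §4 p. 31] -/
theorem Zone_sepInf_probeWorldNS {v u : Site 2} {δ du : MDir} (huv : u ≠ v) (hux : u ≠ v + stepVec δ)
    (huy : u ≠ v + stepVec δ + stepVec du) (δ' : MDir) :
    SepInf (↑(PCells2S.Zone P u δ') : Set (Site 2)) ↑(PCells2S.probeWorldNS P v δ du) :=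
  (sepInf_union_right (P.Zone_sepInf_FarNS huv hux δ')
    (sepInf_union_right (P.Zone_sepInf_Q u δ' _) (P.Zone_sepInf_FarNS hux huy δ'))).mono le_rfl (P.probeWorldNS_subset v δ du)

/-- **`hSQ` (gap-2 form) for the probe world of record.** [cite: KozmaNitzan2024, §4 p. 26 ((29))] -/
theorem Q_sepInf_probeWorldNS (v : Site 2) (δ du : MDir) (u : Site 2) (_hvy : v + stepVec δ + stepVec du ≠ v) (huv : u ≠ v)
    (hux : u ≠ v + stepVec δ) (huy : u ≠ v + stepVec δ + stepVec du) :
    SepInf (↑(PCells2S.Q P u) : Set (Site 2)) ↑(PCells2S.probeWorldNS P v δ du) :=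
  (P.Cell_sepInf_probeWorldNS huv hux huy).mono (Finset.coe_subset.2 (P.Q_subset_Cell u)) le_rfl

/-- **`hSB` (gap-2 form) for the arms and probe world of record** (`w ∉ {x, y}`, `w + δ' ∉ {v, x, y}`; the sibling boxes of `v` included).
[cite: KozmaNitzan2024, §4 p. 31 ((31))] -/
theorem BtwNS_sepInf_probeWorldNS (v : Site 2) (δ du : MDir) (w : Site 2) (δ' : MDir) (_hvy : v + stepVec δ + stepVec du ≠ v)
    (hwx : w ≠ v + stepVec δ) (hwy : w ≠ v + stepVec δ + stepVec du) (hw'v : w + stepVec δ' ≠ v) (hw'x : w + stepVec δ' ≠ v + stepVec δ)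
    (hw'y : w + stepVec δ' ≠ v + stepVec δ + stepVec du) :
    SepInf (↑(PCells2S.BtwNS P w δ') : Set (Site 2)) ↑(PCells2S.probeWorldNS P v δ du) := by
  by_cases hwv : w = v
  · subst hwv
    have hδ : δ' ≠ δ := fun h => hw'x (by rw [h])
    refine PlanarSkeleton.SepInf.mono ?_ le_rfl (P.probeWorldNS_subset w δ du)
    refine sepInf_union_right (P.BtwNS_sepInf_FarNS w hδ) (sepInf_union_right (P.BtwNS_sepInf_Q_add w hδ) ?_)
    refine PlanarSkeleton.SepInf.mono ?_ (Finset.coe_subset.2 (P.BtwNS_subset_Cells w δ')) le_rfl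
    rw [Finset.coe_union]
    refine sepInf_union_left (P.Cell_sepInf_FarNS (Ne.symm ?_) (Ne.symm ?_)) (P.Cell_sepInf_FarNS hw'x hw'y)
    · intro h; exact hwx h.symm
    · intro h; exact hwy h.symm
  · refine PlanarSkeleton.SepInf.mono ?_ (Finset.coe_subset.2 (P.BtwNS_subset_Cells w δ')) le_rfl
    rw [Finset.coe_union]
    exact sepInf_union_left (P.Cell_sepInf_probeWorldNS hwv hwx hwy) (P.Cell_sepInf_probeWorldNS hw'v hw'x hw'y)

/-- **`hSS` (gap-2 form) for the probe world of record** (`u ∉ {v, x, y}`, `j + 1 ≤ K`). [cite: KozmaNitzan2024, §4 p. 31] -/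
theorem Stub_sepInf_probeWorldNS (v : Site 2) (δ du : MDir) (u : Site 2) (du' : MDir) (j : ℕ) (_hvy : v + stepVec δ + stepVec du ≠ v)
    (huv : u ≠ v) (hux : u ≠ v + stepVec δ) (huy : u ≠ v + stepVec δ + stepVec du) (hj : j + 1 ≤ P.K) :
    SepInf (↑(PCells2S.Stub P u du' j) : Set (Site 2)) ↑(PCells2S.probeWorldNS P v δ du) := by
  refine PlanarSkeleton.SepInf.mono ?_ (Finset.coe_subset.2 (P.Stub_subset_Cell_union_Zone u du' (by omega))) le_rfl
  rw [Finset.coe_union]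
  exact sepInf_union_left (P.Cell_sepInf_probeWorldNS huv hux huy) (P.Zone_sepInf_probeWorldNS huv hux huy du')

/-- **`hSQ`, `ℤ²` form.** [cite: KozmaNitzan2024, §4 p. 26 ((29))] -/
theorem Q_sep_probeWorldNS (v : Site 2) (δ du : MDir) (u : Site 2) (hvy : v + stepVec δ + stepVec du ≠ v) (huv : u ≠ v)
    (hux : u ≠ v + stepVec δ) (huy : u ≠ v + stepVec δ + stepVec du) :
    KozmaNitzan.Sep (↑(PCells2S.Q P u) : Set (Site 2)) ↑(PCells2S.probeWorldNS P v δ du) :=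
  sepZ2_of_sepInf (P.Q_sepInf_probeWorldNS v δ du u hvy huv hux huy)

/-- **`hSB`, `ℤ²` form.** [cite: KozmaNitzan2024, §4 p. 31 ((31))] -/
theorem BtwNS_sep_probeWorldNS (v : Site 2) (δ du : MDir) (w : Site 2) (δ' : MDir) (hvy : v + stepVec δ + stepVec du ≠ v)
    (hwx : w ≠ v + stepVec δ) (hwy : w ≠ v + stepVec δ + stepVec du) (hw'v : w + stepVec δ' ≠ v) (hw'x : w + stepVec δ' ≠ v + stepVec δ)
    (hw'y : w + stepVec δ' ≠ v + stepVec δ + stepVec du) :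
    KozmaNitzan.Sep (↑(PCells2S.BtwNS P w δ') : Set (Site 2)) ↑(PCells2S.probeWorldNS P v δ du) :=
  sepZ2_of_sepInf (P.BtwNS_sepInf_probeWorldNS v δ du w δ' hvy hwx hwy hw'v hw'x hw'y)

/-- **`hSS`, `ℤ²` form.** [cite: KozmaNitzan2024, §4 p. 31] -/
theorem Stub_sep_probeWorldNS (v : Site 2) (δ du : MDir) (u : Site 2) (du' : MDir) (j : ℕ) (hvy : v + stepVec δ + stepVec du ≠ v)
    (huv : u ≠ v) (hux : u ≠ v + stepVec δ) (huy : u ≠ v + stepVec δ + stepVec du) (hj : j + 1 ≤ P.K) :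
    KozmaNitzan.Sep (↑(PCells2S.Stub P u du' j) : Set (Site 2)) ↑(PCells2S.probeWorldNS P v δ du) :=
  sepZ2_of_sepInf (P.Stub_sepInf_probeWorldNS v δ du u du' j hvy huv hux huy hj)

end PCells2S

end Transplant
end Summit.CriticalPhenomena.PercolationContinuityZ3.Theorems

end
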